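import Summits.QuantumFields.YangMills.Theorems.BalabanUVNodesN11TStepInnerPrivateCoordinateChart
import Summits.QuantumFields.YangMills.Theorems.BalabanUVNodesN11PrivateChartOfCentralWindow
import Summits.QuantumFields.YangMills.Theorems.BalabanUVNodesN11AveragingSkewPresentationAtRecord

/-!
# DAG node N11 — THE KERNEL-LEVEL (†) ON THE CENTRAL α-WINDOW AT def-R's REGIONS OF RECORD `Y = (Ω_{k+1}(s′))ᶜ` WITH 11a's BOND SETS: every geometric hypothesis
# (`hY`, `hsV`, `hsV′`, `hβ′`, `hac_out`) DISCHARGED — for a.e. `V′` and EVERY `s′`, `(𝐓e^A)_{k+1}(s′)(V′) = 𝐓^{(k)}[∫ inner central-window chart integral]`, modulo the inner support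
# clause, the measurability rows and graph integrability ONLY

HEADER — WORK-UNIT METADATA.  Cell `pub-ymgap`, YM-PLAN Track A (HUMAN RULING D-0062), seat `pub-ymgap-dag-n08-w2` (g9; WIDTH SEAT 2∕4 on N08 [B10], RE-POINTED to
N11's [III] §3-supply residue), route `BalabanUVNodes`, key item K1⁷ `StabilityBAtRecordR13SepCoPH` = stmt-QuantumFields-20542 (helper lane, `--kind proof --supports 20542
--as helper` — jail key; K1⁹ stmt-QuantumFields-27364 is the K1-face of record, mis-key rule; count-neutral; (B4)-socket bookkeeping).  [I] = [Balaban1987RG1],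
[III] = [Balaban1988Convergent].  FILE 12 of this seat's kernel-level socket (FILE 9 p629182 `…N11TStepInnerPrivateCoordinateChart` · FILE 10 p631611 · FILE 11
`…N11TStepInnerCentralWindowChart`).  CONSUMED BY NAME, nothing modified: dag-n11-w6 g2's p629018 `…N11PrivateChartOfCentralWindow` (`exists_perBondCharts_centralWindow_ac`,
`loops_small_of_plaqSmallOn_blocks`), dag-n11-e's `Node00/AveragingSkewPresentation` (`centralBond_mem_bondsIn_iff`, `mem_toFinite_bondsIn_toFinset_iff`,
`map_pi_avgRestrOfRecord_absolutelyContinuous`) and g21's `…N11AveragingSkewPresentationAtRecord` (p615032: ★ `toFine_mem_compl_Omega_iff` — the saturation `hY` at def-R's regions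
of record is a theorem), dag-n09-w6 g3's `N09CentralWindowAtRecord` (`self_mem_centralWindow_iff`).

WHY THIS FILE.  FILE 11 typed def-T's (†) for ALL new sequences `s′` at once as 11a's `kernelRTOfRecord F N K k sV sV′` of the INNER central-window chart integral for a FIXED
saturated fine region `Y` with bond sets `sV ⊇ bondsIn k Y`, `sV′ ⊆ bondsIn (k+1) Y` and `hβ′`.  The (O3′) road (dag-n11-d's `…N11TStepOfRecordSeparated` ∕ `…TStepGenOpJunction`,
dag-n11-w2's `_of_provisos` editions) reads it at def-R's regions of record: `Y := (Ω_{k+1}(s′))ᶜ` — DEPENDING ON `s′` — with 11a's `genDataOfRecord` bond sets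
`sV := (bondsIn k (Ω_{k+1}(s′))ᶜ).toFinset`, `sV′ := (bondsIn (k+1) (Ω_{k+1}(s′))ᶜ).toFinset`.  There every geometric hypothesis is a theorem: `hY` (dag-n11-e ★), `hsV`∕`hsV′`
(`Set.Finite.mem_toFinset`), `hβ′` (§1: `centralBond_mem_bondsIn_iff`), `hac_out` (n11-e ★★).  Since p629018's per-bond bundle `(T, ϑ, jd)` does NOT depend on `Y` and the (2.18)
index of record is FINITE, the same witnesses serve every `s′` and the null set stays UNIFORM in `s′` (FILE 9 ★★★ is applied once per `s′`, to the step weights LOCALISED at `s′`,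
so that the support clause is asked of `s′` at ITS OWN regions only): THERE ARE jointly measurable `(T, ϑ, jd)` such that for `dV′`-a.e. `V′` and EVERY
`s′`, `(𝐓e^A)_{k+1}(s′)(V′) = kernelRTOfRecord F N K k sV(s′) sV′(s′) [y ↦ ∫ dU_in 𝟙·∏ jd · (w(s′)(·,V′)·χ_k(init s′)·T(init s′))(e⁻¹(y, extend β′ (ϑ_c(·, r c))_c U_in))] o` with
`(o, r) = e_{sV′(s′)}⁻¹ V′` — [III] (2.21)∕(3.1) «`∫dV_k|_{Ω^c_{k+1}} δ(V̄_kV_{k+1}⁻¹)χ … ∫dU|_{Ω_{k+1}} δ(…)`» AT PRINT'S OWN REGIONS, the INSIDE δ-functions removed by SOLVING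
`Ū′(c) = V′(c)` for the central bonds of the coarse bonds meeting `Ω_{k+1}(s′)`, the outside ones kept as 11a's TRUE conditional law; displayed: ONLY the three numeric α-guards, the
SUPPORT CLAUSE on the coarse bonds meeting `Ω_{k+1}(s′)` «`w_k(s′)(U,V′) ≠ 0 ⇒ ∀ c ∉ bondsIn (k+1) (Ω_{k+1}(s′))ᶜ, ∀ i, dist1 (loopHol U c i) ≤ α`» ((3.2)–(3.5)), the measurability
rows and GRAPH integrability (dag-n11-w2's `hG_at_record₁₃_of_provisos` discharges the latter at a v1.7 parameter).

WHAT THIS FILE PROVES (0 `def`, 0 `sorry`, standard axioms; `k < K`, `0 ≤ α ≤ 1∕24`, `α < δ_N`, `∀ c, offCard c∕|Idx| + 150α < 1`).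
§1 `centralBond_not_mem_bondsInFinset_compl_Omega` (`hβ′` at the bond sets of record: a coarse bond off `bondsIn (k+1) (Ω_{k+1}(s′))ᶜ` has its central bond off `bondsIn k (Ω_{k+1}(s′))ᶜ`).
§2 ★★★ `exists_ae_forall_tstepOfRecord_eq_kernelRTOfRecord_innerCentralWindow_atRegions` ((†) ∀ `s′`, generic step weights).
§3 ★★ `exists_ae_forall_slotsTOfRecord₁₃H_succ_eq_kernelRTOfRecord_innerCentralWindow_atRegions` (Stage-13 letters: the represented tower's pre-𝐑 slots, the LEFT side of (O3′)
separated at print's regions) · ★ `exists_ae_forall_tstepOfRecord_eq_kernelRTOfRecord_atRegions_of_plaqSmall` (§2 with the support clause in PLAQUETTE currency).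

HONEST FRAMING.  Helper lane of K1⁷ (aside key); count-neutral; by-name composition (FILE 9 + p629018 + dag-n11-e's presentation theorems); the SUPPORT CLAUSE on the coarse bonds
meeting `Ω_{k+1}(s′)` (what def-R's `χ_k(init s′)` ∕ the (3.2)–(3.5) factors of `w_k(s′)` are meant to give — NOT derived here: background-regularity content), the measurability rows
and the GRAPH integrability REMAIN HYPOTHESES, displayed; the Jacobian is a Radon–Nikodym VERSION; NO chart of Bałaban's ((47), [III] (3.10)–(3.25)) asserted — a valid chart of the
disintegration, not print's; nothing of Bałaban ([I] §2, [III] §3, Thm 1–2) asserted; (B4)∕(S-α)∕(O3′) NOT closed; N11 NOT discharged; N08 untouched; K1⁷∕K1⁸∕K1⁹ NOT closed, no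
registered stub touched; counts unmoved (typed 28∕28 · discharged 5∕27 · A 5∕28).  One finite `𝕋⁴_{L^K}` programme at fixed `ε = L^{−K}`; R4 closes only the conditional
finite-𝕋⁴ rung `BalabanLadder.UV` — NOT ℝ⁴, NOT OS, NOT a mass gap, NOT Clay.  No `sorry`, `axiom`, `def`, `instance`, `notation`; global `instDecidableEqPBond` throughout.
Sources (SHAPE ∕ bookkeeping only): [I] (0.4) p.253, (2.9)–(2.10) pp.266–267; [III] (2.1) p.254, (2.17)–(2.18) p.257, (2.21) p.258, (3.1) p.264, (3.2)–(3.5) p.265, p.267 L18–24,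
(3.24)–(3.25) p.270.
-/

noncomputable section

open MeasureTheory ProbabilityTheory Set Function
open scoped ENNReal NNReal

namespace Summit.QuantumFields.YangMills.Theorems.BalabanUVNodesN11TStepInnerCentralWindowChartAtRegions

open Literature.MathematicalPhysics.QuantumFieldTheory.Balaban1983to89
open Literature.MathematicalPhysics.QuantumFieldTheory.Balaban1983to89.T4AveragingDisintegration
open Literature.MathematicalPhysics.QuantumFieldTheory.Balaban1983to89.BlockAveraging (Small Idx avgFun loopHol)
open Literature.MathematicalPhysics.QuantumFieldTheory.Balaban1983to89.BlockAveragingHaarAC (centralBond pre post centralBond_injective isLocal_avgFun)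
open Literature.MathematicalPhysics.QuantumFieldTheory.Balaban1983to89.BlockAveragingEMLHaarAC (fibreFamily offCard)
open Literature.MathematicalPhysics.QuantumFieldTheory.Balaban1983to89.ExpMeanLog (expMeanLogSU deltaSU)
open BalabanUVNodesN11TStepInnerPrivateCoordinateChart BalabanUVNodesN11PrivateChartOfCentralWindow
open BalabanUVNodesN11TransportOfRecordInPrivateCoordinateChart (succ_le_m_add_K)
open BalabanUVNodesN11AveragingSkewPresentationAtRecord (toFine_mem_compl_Omega_iff)
open Summit.QuantumFields.YangMills.BalabanUVNodes.N09CentralWindowAtRecord (self_mem_centralWindow_iff)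

open Node00 hiding SU
open T4Continuum
open B10Eq42TorusConstraint (bondsIn)
open B10Eq38TorusDomains (toFine)

variable {F : T4Family} {N : ℕ} [NeZero N]

/-! ## §1  `hβ′` at 11a's bond sets of def-R's regions of record -/

omit [NeZero N] in
/-- **`hβ′` AT THE BOND SETS OF RECORD**: for a history `s′` of length `k+1`, a coarse bond NOT among the level-`(k+1)` bonds of `(Ω_{k+1}(s′))ᶜ` has its central crossing bond NOT
among the level-`k` bonds of `(Ω_{k+1}(s′))ᶜ` — dag-n11-e's `centralBond_mem_bondsIn_iff` at the saturation ★ `toFine_mem_compl_Omega_iff` of def-R's regions.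
[cite: Balaban1988Convergent, (2.1) p.254, (2.21) p.258; Balaban1987RG1, (0.4) p.253 (bookkeeping)] -/
theorem centralBond_not_mem_bondsInFinset_compl_Omega {ν : Stage7Numerics} {M : ℕ} {g : ℕ → ℝ} {K k : ℕ} (hk : k < K) (s' : SeqOfRecord F ν M g K (k + 1))
    (c : PBond (F.P K) (k + 1)) (hc : c ∉ (Set.toFinite (bondsIn (k + 1) (s'.Ω (k + 1))ᶜ)).toFinset) :
    centralBond c ∉ (Set.toFinite (bondsIn k (s'.Ω (k + 1))ᶜ)).toFinset := fun h =>
  hc ((mem_toFinite_bondsIn_toFinset_iff _ c).2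
    ((centralBond_mem_bondsIn_iff (succ_le_m_add_K hk) (toFine_mem_compl_Omega_iff s' (succ_le_m_add_K hk)) c).1
      ((mem_toFinite_bondsIn_toFinset_iff _ (centralBond c)).1 h)))

/-! ## §2  def-T's (†) for ALL new sequences at once at def-R's regions of record, the inner step charted on the central α-windows -/

section TStep

variable (p : B12.RunParams) {k : ℕ}

/-- **★★★ def-T's (†) AT def-R's REGIONS OF RECORD, ALL `s′` AT ONCE, NO GEOMETRIC AND NO PER-BOND HYPOTHESIS**: at step `k < p.K`, for `0 ≤ α ≤ 1∕24`, `α < δ_N`,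
`offCard c∕|Idx| + 150α < 1`, step weights with measurable sections (`hw`, `hwj`), measurable `χ_k(s)`, `T(s)`, the SUPPORT CLAUSE on the coarse bonds meeting `Ω_{k+1}(s′)`
«`w_k(s′)(U, V′) ≠ 0 ⇒ ∀ c ∉ bondsIn (k+1) (Ω_{k+1}(s′))ᶜ, ∀ i, dist1 (loopHol U c i) ≤ α`» ((3.2)–(3.5) — DISPLAYED) and GRAPH-integrable (†) integrands: THERE ARE jointly
measurable `(T, ϑ, jd)` such that for `dV′`-a.e. `V′` and EVERY `s′`, with `Y := (Ω_{k+1}(s′))ᶜ`, `sV := (bondsIn k Y).toFinset`, `sV′ := (bondsIn (k+1) Y).toFinset` (11a's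
`genDataOfRecord` bond sets), `(o, r) := e_{sV′}⁻¹V′`, `e := e_{sV}⁻¹`:
`(𝐓e^A)_{k+1}(s′)(V′) = kernelRTOfRecord F N K k sV sV′ (y ↦ ∫ dU_in 𝟙[∀ c ∉ sV′, r c ∈ T_c(e(y,U_in))]·∏_{c ∉ sV′} jd_c(e(y,U_in), r c) · (w(s′)(·,V′)·χ_k·T)(e(y, extend β′ (ϑ_c(e(y,U_in), r c))_c U_in))) o`
— FILE 9 ★★★ at p629018's bundle, `hY`∕`hsV`∕`hsV′`∕`hβ′`∕`hac_out` discharged by dag-n11-e's theorems; applied, for each `s′`, to the step-weight family LOCALISED at `s′` (every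
other sequence weighted `0` — def-T's `tstepOfRecord … s′` reads the weights at `s′` only, `tstepOfRecord_apply`), so that only `s′` itself must carry the support clause at its own
regions; the null set is uniform in `s′` because the (2.18) index is finite (`ae_all_iff`).
[cite: Balaban1988Convergent, (2.1) p.254, (2.18) p.257, (2.21) p.258, (3.1) p.264, (3.2)–(3.5) p.265, p.267 L18–24; Balaban1987RG1, (0.4) p.253, (2.9)–(2.10) pp.266–267] -/
theorem exists_ae_forall_tstepOfRecord_eq_kernelRTOfRecord_innerCentralWindow_atRegions
    (ν : Stage7Numerics) (M : ℕ) (w : StepWeightsOfRecord F N ν M) (g : ℕ → ℝ) (hk : k < p.K) (T' : SeqOfRecord F ν M g p.K k → Density (F.P p.K) k (SU N))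
    {α : ℝ} (hα0 : 0 ≤ α) (hα : α ≤ 1 / 24) (hαδ : α < deltaSU (Fin N))
    (hgap : ∀ c : PBond (F.P p.K) (k + 1), (offCard c : ℝ) / (Fintype.card (Idx (F.P p.K)) : ℝ) + 150 * α < 1)
    (hw : ∀ s' V', Measurable fun U => w p g k s' U V') (hwj : ∀ s', Measurable fun q : GaugeField (F.P p.K) (k + 1) (SU N) × GaugeField (F.P p.K) k (SU N) =>
      w p g k s' q.2 q.1)
    (hχ : ∀ s, Measurable (chiSeqOfRecord F N ν M g p.K k s)) (hT : ∀ s, Measurable (T' s))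
    (hwS : ∀ (s' : SeqOfRecord F ν M g p.K (k + 1)) (U : GaugeField (F.P p.K) k (SU N)) V', w p g k s' U V' ≠ 0 →
      ∀ c : PBond (F.P p.K) (k + 1), c ∉ bondsIn (k + 1) (s'.Ω (k + 1))ᶜ → ∀ i : Idx (F.P p.K), dist1 (loopHol U c i) ≤ α)
    (hGi : ∀ s' : SeqOfRecord F ν M g p.K (k + 1),
      Integrable (fun U => w p g k s' U ((avOfRecord F N p.K k).avg U) * (chiSeqOfRecord F N ν M g p.K k s'.init U * T' s'.init U))
        (fieldMeasure (F.P p.K) k (SU N))) :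
    ∃ (T : PBond (F.P p.K) (k + 1) → GaugeField (F.P p.K) k (SU N) → Set (SU N))
      (ϑ : PBond (F.P p.K) (k + 1) → GaugeField (F.P p.K) k (SU N) → SU N → SU N)
      (jd : PBond (F.P p.K) (k + 1) → GaugeField (F.P p.K) k (SU N) → SU N → ℝ≥0),
      (∀ c, MeasurableSet {q : GaugeField (F.P p.K) k (SU N) × SU N | q.2 ∈ T c q.1}) ∧
      (∀ c, Measurable fun q : GaugeField (F.P p.K) k (SU N) × SU N => ϑ c q.1 q.2) ∧
      (∀ c, Measurable fun q : GaugeField (F.P p.K) k (SU N) × SU N => jd c q.1 q.2) ∧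
      ∀ᵐ V' ∂(fieldMeasure (F.P p.K) (k + 1) (SU N)), ∀ s' : SeqOfRecord F ν M g p.K (k + 1),
        tstepOfRecord F N ν M w p g k T' s' V' =
          kernelRTOfRecord F N p.K k (Set.toFinite (bondsIn k (s'.Ω (k + 1))ᶜ)).toFinset (Set.toFinite (bondsIn (k + 1) (s'.Ω (k + 1))ᶜ)).toFinset
            (fun y => ∫ uin,
              (({z : ((↥(Set.toFinite (bondsIn k (s'.Ω (k + 1))ᶜ)).toFinset → SU N) ×
                    ({c : PBond (F.P p.K) (k + 1) // c ∉ (Set.toFinite (bondsIn (k + 1) (s'.Ω (k + 1))ᶜ)).toFinset} → SU N)) ×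
                    ({b : PBond (F.P p.K) k // b ∉ (Set.toFinite (bondsIn k (s'.Ω (k + 1))ᶜ)).toFinset} → SU N) |
                  ∀ c : {c : PBond (F.P p.K) (k + 1) // c ∉ (Set.toFinite (bondsIn (k + 1) (s'.Ω (k + 1))ᶜ)).toFinset},
                    z.1.2 c ∈ T c ((MeasurableEquiv.piEquivPiSubtypeProd (fun _ : PBond (F.P p.K) k => SU N)
                      (· ∈ (Set.toFinite (bondsIn k (s'.Ω (k + 1))ᶜ)).toFinset)).symm (z.1.1, z.2))}.indicator
                (fun z => ∏ c : {c : PBond (F.P p.K) (k + 1) // c ∉ (Set.toFinite (bondsIn (k + 1) (s'.Ω (k + 1))ᶜ)).toFinset},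
                  jd c ((MeasurableEquiv.piEquivPiSubtypeProd (fun _ : PBond (F.P p.K) k => SU N)
                    (· ∈ (Set.toFinite (bondsIn k (s'.Ω (k + 1))ᶜ)).toFinset)).symm (z.1.1, z.2)) (z.1.2 c))
                ((y, (MeasurableEquiv.piEquivPiSubtypeProd (fun _ : PBond (F.P p.K) (k + 1) => SU N)
                  (· ∈ (Set.toFinite (bondsIn (k + 1) (s'.Ω (k + 1))ᶜ)).toFinset) V').2), uin) : ℝ≥0) : ℝ) *
              ((fun U : GaugeField (F.P p.K) k (SU N) => w p g k s' U V' * (chiSeqOfRecord F N ν M g p.K k s'.init U * T' s'.init U))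
                ((MeasurableEquiv.piEquivPiSubtypeProd (fun _ : PBond (F.P p.K) k => SU N)
                  (· ∈ (Set.toFinite (bondsIn k (s'.Ω (k + 1))ᶜ)).toFinset)).symm (y,
                  extend (fun c : {c : PBond (F.P p.K) (k + 1) // c ∉ (Set.toFinite (bondsIn (k + 1) (s'.Ω (k + 1))ᶜ)).toFinset} =>
                      (⟨centralBond (c : PBond (F.P p.K) (k + 1)), centralBond_not_mem_bondsInFinset_compl_Omega hk s' c c.2⟩ :
                        {b : PBond (F.P p.K) k // b ∉ (Set.toFinite (bondsIn k (s'.Ω (k + 1))ᶜ)).toFinset}))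
                    (fun c : {c : PBond (F.P p.K) (k + 1) // c ∉ (Set.toFinite (bondsIn (k + 1) (s'.Ω (k + 1))ᶜ)).toFinset} =>
                      ϑ c ((MeasurableEquiv.piEquivPiSubtypeProd (fun _ : PBond (F.P p.K) k => SU N)
                        (· ∈ (Set.toFinite (bondsIn k (s'.Ω (k + 1))ᶜ)).toFinset)).symm (y, uin))
                        ((MeasurableEquiv.piEquivPiSubtypeProd (fun _ : PBond (F.P p.K) (k + 1) => SU N)
                          (· ∈ (Set.toFinite (bondsIn (k + 1) (s'.Ω (k + 1))ᶜ)).toFinset) V').2 c)) uin)))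
              ∂(Measure.pi fun _ : {b : PBond (F.P p.K) k // b ∉ (Set.toFinite (bondsIn k (s'.Ω (k + 1))ᶜ)).toFinset} => (HaarData.haar : Measure (SU N))))
            (MeasurableEquiv.piEquivPiSubtypeProd (fun _ : PBond (F.P p.K) (k + 1) => SU N)
              (· ∈ (Set.toFinite (bondsIn (k + 1) (s'.Ω (k + 1))ᶜ)).toFinset) V').1 := by
  have hkr : k + 1 ≤ (F.P p.K).m + (F.P p.K).K := succ_le_m_add_K hk
  obtain ⟨T, ϑ, jd, hΩm, hΩbl, hTm, hθm, hjm, hright, hlaw, -, -, -⟩ :=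
    exists_perBondCharts_centralWindow_ac (F := F) (N := N) hk hα0 hα hαδ hgap
  refine ⟨T, ϑ, jd, hTm, hθm, hjm, ?_⟩
  rw [MeasureTheory.ae_all_iff]
  intro s'
  -- the geometric hypotheses at `Y := (Ω_{k+1}(s′))ᶜ` with 11a's bond sets are theorems (dag-n11-e)
  have hY := toFine_mem_compl_Omega_iff s' hkr
  have hsV : ∀ b : PBond (F.P p.K) k, b ∈ bondsIn k (s'.Ω (k + 1))ᶜ → b ∈ (Set.toFinite (bondsIn k (s'.Ω (k + 1))ᶜ)).toFinset :=
    fun b hb => (mem_toFinite_bondsIn_toFinset_iff _ b).2 hb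
  have hsV' : ∀ c : PBond (F.P p.K) (k + 1), c ∈ (Set.toFinite (bondsIn (k + 1) (s'.Ω (k + 1))ᶜ)).toFinset → c ∈ bondsIn (k + 1) (s'.Ω (k + 1))ᶜ :=
    fun c hc => (mem_toFinite_bondsIn_toFinset_iff _ c).1 hc
  have hac_out := map_pi_avgRestrOfRecord_absolutelyContinuous F N p.K k hkr hY hsV hsV'
  -- FILE 9 ★★★ is uniform in the new sequence for a FIXED presentation; at the presentation of `s′` only `s′` itself carries the support clause, so we feed it the
  -- step-weight family LOCALISED at `s′` (all other sequences weighted `0`) — def-T's `tstepOfRecord … s′` reads `w` at `s′` only (`tstepOfRecord_apply`)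
  classical
  obtain ⟨w', hw'⟩ : ∃ w' : StepWeightsOfRecord F N ν M, ∀ p₁ g₁ k₁ s₁ U V', w' p₁ g₁ k₁ s₁ U V' = if HEq s₁ s' then w p₁ g₁ k₁ s₁ U V' else 0 :=
    ⟨fun p₁ g₁ k₁ s₁ U V' => if HEq s₁ s' then w p₁ g₁ k₁ s₁ U V' else 0, fun _ _ _ _ _ _ => rfl⟩
  have hw's : ∀ U V', w' p g k s' U V' = w p g k s' U V' := fun U V' => by rw [hw', if_pos HEq.rfl]
  have hw'o : ∀ s'' : SeqOfRecord F ν M g p.K (k + 1), ¬ HEq s'' s' → ∀ U V', w' p g k s'' U V' = 0 := fun s'' h U V' => by rw [hw', if_neg h]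
  have hw₁ : ∀ (s'' : SeqOfRecord F ν M g p.K (k + 1)) V', Measurable fun U => w' p g k s'' U V' := by
    intro s'' V'
    by_cases h : HEq s'' s'
    · obtain rfl : s'' = s' := eq_of_heq h
      simp only [hw's]; exact hw s'' V'
    · simp only [hw'o s'' h]; exact measurable_const
  have hwj₁ : ∀ s'' : SeqOfRecord F ν M g p.K (k + 1), Measurable fun q : GaugeField (F.P p.K) (k + 1) (SU N) × GaugeField (F.P p.K) k (SU N) =>
      w' p g k s'' q.2 q.1 := by
    intro s''
    by_cases h : HEq s'' s'
    · obtain rfl : s'' = s' := eq_of_heq h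
      simp only [hw's]; exact hwj s''
    · simp only [hw'o s'' h]; exact measurable_const
  have hwΩ₁ : ∀ (s'' : SeqOfRecord F ν M g p.K (k + 1)) (U : GaugeField (F.P p.K) k (SU N)) V', w' p g k s'' U V' ≠ 0 →
      ∀ c : PBond (F.P p.K) (k + 1), c ∉ (Set.toFinite (bondsIn (k + 1) (s'.Ω (k + 1))ᶜ)).toFinset →
        U (centralBond c) ∈ {g' : SU N | ∀ i : Idx (F.P p.K), dist1 (fibreFamily U c (pre U c * g' * post U c) i) ≤ α} := by
    intro s'' U V' hne c hc
    by_cases h : HEq s'' s'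
    · obtain rfl : s'' = s' := eq_of_heq h
      rw [hw's] at hne
      exact (self_mem_centralWindow_iff hkr U c α).2 (hwS s'' U V' hne c fun hc' => hc ((mem_toFinite_bondsIn_toFinset_iff _ c).2 hc'))
    · exact absurd (hw'o s'' h U V') hne
  have hGi₁ : ∀ s'' : SeqOfRecord F ν M g p.K (k + 1),
      Integrable (fun U => w' p g k s'' U ((avOfRecord F N p.K k).avg U) * (chiSeqOfRecord F N ν M g p.K k s''.init U * T' s''.init U))
        (fieldMeasure (F.P p.K) k (SU N)) := by
    intro s''
    by_cases h : HEq s'' s'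
    · obtain rfl : s'' = s' := eq_of_heq h
      simp only [hw's]; exact hGi s''
    · simp only [hw'o s'' h, zero_mul]; exact integrable_zero _ _ _
  filter_upwards [ae_forall_tstepOfRecord_eq_kernelRTOfRecord_innerPrivateChart p
    (fun c U => {g' : SU N | ∀ i : Idx (F.P p.K), dist1 (fibreFamily U c (pre U c * g' * post U c) i) ≤ α})
    T ϑ jd ν M w' g hk T' hY hsV hsV' (centralBond_not_mem_bondsInFinset_compl_Omega hk s') hac_out hΩm hTm hθm hjm hΩbl hright hlaw hw₁ hwj₁ hχ hT
    hwΩ₁ hGi₁] with V' hV'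
  have h1 := hV' s'
  simp only [tstepOfRecord_apply, hw's] at h1 ⊢
  exact h1

/-- **★ THE SAME WITH THE SUPPORT CLAUSE IN PLAQUETTE CURRENCY**: wherever `w_k(s′)(U, V′) ≠ 0`, at every coarse bond `c ∉ bondsIn (k+1) (Ω_{k+1}(s′))ᶜ` every fine plaquette based in
the three blocks `B(c₋ − e_μ) ∪ B(c₋) ∪ B(c₊)` is within `δ` of `1`, `0 ≤ δ`, `((d+2)L)²∕4 · δ ≤ α` (p629018 `loops_small_of_plaqSmallOn_blocks`).
[cite: Balaban1988Convergent, (2.17) p.257, (2.21) p.258, (3.1) p.264, (3.3) p.265, p.267 L18–24; Balaban1987RG1, (0.4) p.253, (2.9) p.266] -/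
theorem exists_ae_forall_tstepOfRecord_eq_kernelRTOfRecord_atRegions_of_plaqSmall
    (ν : Stage7Numerics) (M : ℕ) (w : StepWeightsOfRecord F N ν M) (g : ℕ → ℝ) (hk : k < p.K) (T' : SeqOfRecord F ν M g p.K k → Density (F.P p.K) k (SU N))
    {α : ℝ} (hα0 : 0 ≤ α) (hα : α ≤ 1 / 24) (hαδ : α < deltaSU (Fin N))
    (hgap : ∀ c : PBond (F.P p.K) (k + 1), (offCard c : ℝ) / (Fintype.card (Idx (F.P p.K)) : ℝ) + 150 * α < 1)
    {δ : ℝ} (hδ : 0 ≤ δ) (hδα : ((((F.P p.K).d + 2) * (F.P p.K).L : ℕ) : ℝ) ^ 2 / 4 * δ ≤ α)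
    (hw : ∀ s' V', Measurable fun U => w p g k s' U V') (hwj : ∀ s', Measurable fun q : GaugeField (F.P p.K) (k + 1) (SU N) × GaugeField (F.P p.K) k (SU N) =>
      w p g k s' q.2 q.1)
    (hχ : ∀ s, Measurable (chiSeqOfRecord F N ν M g p.K k s)) (hT : ∀ s, Measurable (T' s))
    (hwq : ∀ (s' : SeqOfRecord F ν M g p.K (k + 1)) (U : GaugeField (F.P p.K) k (SU N)) V', w p g k s' U V' ≠ 0 →
      ∀ c : PBond (F.P p.K) (k + 1), c ∉ bondsIn (k + 1) (s'.Ω (k + 1))ᶜ → ∀ q : Plaq (F.P p.K) k,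
        (blockOf q.src = c.src.unshift c.dir ∨ blockOf q.src = c.src ∨ blockOf q.src = c.tgt) → dist1 (GaugeField.plaqHol U q) < δ)
    (hGi : ∀ s' : SeqOfRecord F ν M g p.K (k + 1),
      Integrable (fun U => w p g k s' U ((avOfRecord F N p.K k).avg U) * (chiSeqOfRecord F N ν M g p.K k s'.init U * T' s'.init U))
        (fieldMeasure (F.P p.K) k (SU N))) :
    ∃ (T : PBond (F.P p.K) (k + 1) → GaugeField (F.P p.K) k (SU N) → Set (SU N))
      (ϑ : PBond (F.P p.K) (k + 1) → GaugeField (F.P p.K) k (SU N) → SU N → SU N)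
      (jd : PBond (F.P p.K) (k + 1) → GaugeField (F.P p.K) k (SU N) → SU N → ℝ≥0),
      (∀ c, MeasurableSet {q : GaugeField (F.P p.K) k (SU N) × SU N | q.2 ∈ T c q.1}) ∧
      (∀ c, Measurable fun q : GaugeField (F.P p.K) k (SU N) × SU N => ϑ c q.1 q.2) ∧
      (∀ c, Measurable fun q : GaugeField (F.P p.K) k (SU N) × SU N => jd c q.1 q.2) ∧
      ∀ᵐ V' ∂(fieldMeasure (F.P p.K) (k + 1) (SU N)), ∀ s' : SeqOfRecord F ν M g p.K (k + 1),
        tstepOfRecord F N ν M w p g k T' s' V' =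
          kernelRTOfRecord F N p.K k (Set.toFinite (bondsIn k (s'.Ω (k + 1))ᶜ)).toFinset (Set.toFinite (bondsIn (k + 1) (s'.Ω (k + 1))ᶜ)).toFinset
            (fun y => ∫ uin,
              (({z : ((↥(Set.toFinite (bondsIn k (s'.Ω (k + 1))ᶜ)).toFinset → SU N) ×
                    ({c : PBond (F.P p.K) (k + 1) // c ∉ (Set.toFinite (bondsIn (k + 1) (s'.Ω (k + 1))ᶜ)).toFinset} → SU N)) ×
                    ({b : PBond (F.P p.K) k // b ∉ (Set.toFinite (bondsIn k (s'.Ω (k + 1))ᶜ)).toFinset} → SU N) |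
                  ∀ c : {c : PBond (F.P p.K) (k + 1) // c ∉ (Set.toFinite (bondsIn (k + 1) (s'.Ω (k + 1))ᶜ)).toFinset},
                    z.1.2 c ∈ T c ((MeasurableEquiv.piEquivPiSubtypeProd (fun _ : PBond (F.P p.K) k => SU N)
                      (· ∈ (Set.toFinite (bondsIn k (s'.Ω (k + 1))ᶜ)).toFinset)).symm (z.1.1, z.2))}.indicator
                (fun z => ∏ c : {c : PBond (F.P p.K) (k + 1) // c ∉ (Set.toFinite (bondsIn (k + 1) (s'.Ω (k + 1))ᶜ)).toFinset},
                  jd c ((MeasurableEquiv.piEquivPiSubtypeProd (fun _ : PBond (F.P p.K) k => SU N)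
                    (· ∈ (Set.toFinite (bondsIn k (s'.Ω (k + 1))ᶜ)).toFinset)).symm (z.1.1, z.2)) (z.1.2 c))
                ((y, (MeasurableEquiv.piEquivPiSubtypeProd (fun _ : PBond (F.P p.K) (k + 1) => SU N)
                  (· ∈ (Set.toFinite (bondsIn (k + 1) (s'.Ω (k + 1))ᶜ)).toFinset) V').2), uin) : ℝ≥0) : ℝ) *
              ((fun U : GaugeField (F.P p.K) k (SU N) => w p g k s' U V' * (chiSeqOfRecord F N ν M g p.K k s'.init U * T' s'.init U))
                ((MeasurableEquiv.piEquivPiSubtypeProd (fun _ : PBond (F.P p.K) k => SU N)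
                  (· ∈ (Set.toFinite (bondsIn k (s'.Ω (k + 1))ᶜ)).toFinset)).symm (y,
                  extend (fun c : {c : PBond (F.P p.K) (k + 1) // c ∉ (Set.toFinite (bondsIn (k + 1) (s'.Ω (k + 1))ᶜ)).toFinset} =>
                      (⟨centralBond (c : PBond (F.P p.K) (k + 1)), centralBond_not_mem_bondsInFinset_compl_Omega hk s' c c.2⟩ :
                        {b : PBond (F.P p.K) k // b ∉ (Set.toFinite (bondsIn k (s'.Ω (k + 1))ᶜ)).toFinset}))
                    (fun c : {c : PBond (F.P p.K) (k + 1) // c ∉ (Set.toFinite (bondsIn (k + 1) (s'.Ω (k + 1))ᶜ)).toFinset} =>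
                      ϑ c ((MeasurableEquiv.piEquivPiSubtypeProd (fun _ : PBond (F.P p.K) k => SU N)
                        (· ∈ (Set.toFinite (bondsIn k (s'.Ω (k + 1))ᶜ)).toFinset)).symm (y, uin))
                        ((MeasurableEquiv.piEquivPiSubtypeProd (fun _ : PBond (F.P p.K) (k + 1) => SU N)
                          (· ∈ (Set.toFinite (bondsIn (k + 1) (s'.Ω (k + 1))ᶜ)).toFinset) V').2 c)) uin)))
              ∂(Measure.pi fun _ : {b : PBond (F.P p.K) k // b ∉ (Set.toFinite (bondsIn k (s'.Ω (k + 1))ᶜ)).toFinset} => (HaarData.haar : Measure (SU N))))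
            (MeasurableEquiv.piEquivPiSubtypeProd (fun _ : PBond (F.P p.K) (k + 1) => SU N)
              (· ∈ (Set.toFinite (bondsIn (k + 1) (s'.Ω (k + 1))ᶜ)).toFinset) V').1 :=
  exists_ae_forall_tstepOfRecord_eq_kernelRTOfRecord_innerCentralWindow_atRegions p ν M w g hk T' hα0 hα hαδ hgap hw hwj hχ hT
    (fun s' U V' h c hc i => loops_small_of_plaqSmallOn_blocks (succ_le_m_add_K hk) hδ hδα U c (hwq s' U V' h c hc) i) hGi

/-! ## §3  Stage-13 letters: the represented tower's pre-𝐑 slots at def-R's regions of record -/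

/-- **★★ THE REPRESENTED TOWER'S PRE-𝐑 SLOTS AT LEVEL k+1 AT def-R's REGIONS OF RECORD, SEPARATED, EVERY HISTORY AT ONCE** (the LEFT side of N11's 𝐓-present child obligation
(O3′) in 11a's `kernelRTOfRecord` ∕ `genDataOfRecord` currency, no geometric and no per-bond hypothesis): at a v1.7 parameter `θ`, `k < K`, small `α`, def-K0a's step weights of record
with measurable sections, the SUPPORT CLAUSE on the coarse bonds meeting `Ω_{k+1}(s)` «`w_k(s)(U, V′) ≠ 0 ⇒ ∀ c ∉ bondsIn (k+1) (Ω_{k+1}(s))ᶜ, ∀ i, dist1 (loopHol U c i) ≤ α`»,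
measurable `χ_k(s₀)`, `slot_k(s₀)` and GRAPH-integrable slot integrands (dag-n11-w2's `hG_at_record₁₃_of_provisos` at `θ.Provisos₁₃CoPH`): THERE ARE jointly measurable `(T, ϑ, jd)`
such that for `dV′`-a.e. `V′` and every length-(k+1) history `s`, `slotsT_{k+1}(s)(V′) = kernelRTOfRecord F N K k sV(s) sV′(s) [y ↦ ∫ dU_in 𝟙·∏ jd ·
(w_k(s)(·,V′)·χ_k(init s)·slot_k(init s))(e(y, extend β′ (ϑ_c(·, r c))_c U_in))] o` — §2 at `T := slot_k`, `w := wOfRecord₉` (`slotsTOfRecord_succ` is `rfl`).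
[cite: Balaban1988Convergent, (2.18) p.257, (2.21) p.258, (3.1) p.264, (3.2)–(3.5) p.265, p.267 L18–24, (3.24)–(3.25) p.270; Balaban1987RG1, (0.4) p.253, (2.9)–(2.10) pp.266–267] -/
theorem exists_ae_forall_slotsTOfRecord₁₃H_succ_eq_kernelRTOfRecord_innerCentralWindow_atRegions (θ : Stage13HParams F N) (hk : k < p.K)
    {α : ℝ} (hα0 : 0 ≤ α) (hα : α ≤ 1 / 24) (hαδ : α < deltaSU (Fin N))
    (hgap : ∀ c : PBond (F.P p.K) (k + 1), (offCard c : ℝ) / (Fintype.card (Idx (F.P p.K)) : ℝ) + 150 * α < 1)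
    (hw : ∀ (s : SeqOfRecord F θ.ν θ.τ9.M (gOfRecord₁₃ F N θ.toStage13Params p) p.K (k + 1)) (V' : GaugeField (F.P p.K) (k + 1) (SU N)),
      Measurable fun U => wOfRecord₉ F N θ.toStage9Params p (gOfRecord₁₃ F N θ.toStage13Params p) k s U V')
    (hwj : ∀ s : SeqOfRecord F θ.ν θ.τ9.M (gOfRecord₁₃ F N θ.toStage13Params p) p.K (k + 1),
      Measurable fun q : GaugeField (F.P p.K) (k + 1) (SU N) × GaugeField (F.P p.K) k (SU N) =>
        wOfRecord₉ F N θ.toStage9Params p (gOfRecord₁₃ F N θ.toStage13Params p) k s q.2 q.1)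
    (hχ : ∀ s₀ : SeqOfRecord F θ.ν θ.τ9.M (gOfRecord₁₃ F N θ.toStage13Params p) p.K k,
      Measurable (chiSeqOfRecord F N θ.ν θ.τ9.M (gOfRecord₁₃ F N θ.toStage13Params p) p.K k s₀))
    (hslot : ∀ s₀ : SeqOfRecord F θ.ν θ.τ9.M (gOfRecord₁₃ F N θ.toStage13Params p) p.K k,
      Measurable (slotsOfRecord F N θ.ν θ.τ9 (EOfRecord₁₃ F N θ.toStage13Params) (wOfRecord₉ F N θ.toStage9Params) θ.ppSel p (gOfRecord₁₃ F N θ.toStage13Params p) k s₀))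
    (hwS : ∀ (s : SeqOfRecord F θ.ν θ.τ9.M (gOfRecord₁₃ F N θ.toStage13Params p) p.K (k + 1)) (U : GaugeField (F.P p.K) k (SU N))
      (V' : GaugeField (F.P p.K) (k + 1) (SU N)),
      wOfRecord₉ F N θ.toStage9Params p (gOfRecord₁₃ F N θ.toStage13Params p) k s U V' ≠ 0 →
        ∀ c : PBond (F.P p.K) (k + 1), c ∉ bondsIn (k + 1) (s.Ω (k + 1))ᶜ → ∀ i : Idx (F.P p.K), dist1 (loopHol U c i) ≤ α)
    (hGi : ∀ s : SeqOfRecord F θ.ν θ.τ9.M (gOfRecord₁₃ F N θ.toStage13Params p) p.K (k + 1),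
      Integrable (fun U => wOfRecord₉ F N θ.toStage9Params p (gOfRecord₁₃ F N θ.toStage13Params p) k s U ((avOfRecord F N p.K k).avg U) *
        (chiSeqOfRecord F N θ.ν θ.τ9.M (gOfRecord₁₃ F N θ.toStage13Params p) p.K k s.init U *
          slotsOfRecord F N θ.ν θ.τ9 (EOfRecord₁₃ F N θ.toStage13Params) (wOfRecord₉ F N θ.toStage9Params) θ.ppSel p (gOfRecord₁₃ F N θ.toStage13Params p) k s.init U))
        (fieldMeasure (F.P p.K) k (SU N))) :
    ∃ (T : PBond (F.P p.K) (k + 1) → GaugeField (F.P p.K) k (SU N) → Set (SU N))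
      (ϑ : PBond (F.P p.K) (k + 1) → GaugeField (F.P p.K) k (SU N) → SU N → SU N)
      (jd : PBond (F.P p.K) (k + 1) → GaugeField (F.P p.K) k (SU N) → SU N → ℝ≥0),
      (∀ c, MeasurableSet {q : GaugeField (F.P p.K) k (SU N) × SU N | q.2 ∈ T c q.1}) ∧
      (∀ c, Measurable fun q : GaugeField (F.P p.K) k (SU N) × SU N => ϑ c q.1 q.2) ∧
      (∀ c, Measurable fun q : GaugeField (F.P p.K) k (SU N) × SU N => jd c q.1 q.2) ∧
      ∀ᵐ V' ∂(fieldMeasure (F.P p.K) (k + 1) (SU N)), ∀ s : SeqOfRecord F θ.ν θ.τ9.M (gOfRecord₁₃ F N θ.toStage13Params p) p.K (k + 1),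
        slotsTOfRecord F N θ.ν θ.τ9 (EOfRecord₁₃ F N θ.toStage13Params) (wOfRecord₉ F N θ.toStage9Params) θ.ppSel p (gOfRecord₁₃ F N θ.toStage13Params p) (k + 1) s V' =
          kernelRTOfRecord F N p.K k (Set.toFinite (bondsIn k (s.Ω (k + 1))ᶜ)).toFinset (Set.toFinite (bondsIn (k + 1) (s.Ω (k + 1))ᶜ)).toFinset
            (fun y => ∫ uin,
              (({z : ((↥(Set.toFinite (bondsIn k (s.Ω (k + 1))ᶜ)).toFinset → SU N) ×
                    ({c : PBond (F.P p.K) (k + 1) // c ∉ (Set.toFinite (bondsIn (k + 1) (s.Ω (k + 1))ᶜ)).toFinset} → SU N)) ×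
                    ({b : PBond (F.P p.K) k // b ∉ (Set.toFinite (bondsIn k (s.Ω (k + 1))ᶜ)).toFinset} → SU N) |
                  ∀ c : {c : PBond (F.P p.K) (k + 1) // c ∉ (Set.toFinite (bondsIn (k + 1) (s.Ω (k + 1))ᶜ)).toFinset},
                    z.1.2 c ∈ T c ((MeasurableEquiv.piEquivPiSubtypeProd (fun _ : PBond (F.P p.K) k => SU N)
                      (· ∈ (Set.toFinite (bondsIn k (s.Ω (k + 1))ᶜ)).toFinset)).symm (z.1.1, z.2))}.indicator
                (fun z => ∏ c : {c : PBond (F.P p.K) (k + 1) // c ∉ (Set.toFinite (bondsIn (k + 1) (s.Ω (k + 1))ᶜ)).toFinset},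
                  jd c ((MeasurableEquiv.piEquivPiSubtypeProd (fun _ : PBond (F.P p.K) k => SU N)
                    (· ∈ (Set.toFinite (bondsIn k (s.Ω (k + 1))ᶜ)).toFinset)).symm (z.1.1, z.2)) (z.1.2 c))
                ((y, (MeasurableEquiv.piEquivPiSubtypeProd (fun _ : PBond (F.P p.K) (k + 1) => SU N)
                  (· ∈ (Set.toFinite (bondsIn (k + 1) (s.Ω (k + 1))ᶜ)).toFinset) V').2), uin) : ℝ≥0) : ℝ) *
              ((fun U : GaugeField (F.P p.K) k (SU N) =>
                  wOfRecord₉ F N θ.toStage9Params p (gOfRecord₁₃ F N θ.toStage13Params p) k s U V' *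
                    (chiSeqOfRecord F N θ.ν θ.τ9.M (gOfRecord₁₃ F N θ.toStage13Params p) p.K k s.init U *
                      slotsOfRecord F N θ.ν θ.τ9 (EOfRecord₁₃ F N θ.toStage13Params) (wOfRecord₉ F N θ.toStage9Params) θ.ppSel p
                        (gOfRecord₁₃ F N θ.toStage13Params p) k s.init U))
                ((MeasurableEquiv.piEquivPiSubtypeProd (fun _ : PBond (F.P p.K) k => SU N)
                  (· ∈ (Set.toFinite (bondsIn k (s.Ω (k + 1))ᶜ)).toFinset)).symm (y,
                  extend (fun c : {c : PBond (F.P p.K) (k + 1) // c ∉ (Set.toFinite (bondsIn (k + 1) (s.Ω (k + 1))ᶜ)).toFinset} =>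
                      (⟨centralBond (c : PBond (F.P p.K) (k + 1)), centralBond_not_mem_bondsInFinset_compl_Omega hk s c c.2⟩ :
                        {b : PBond (F.P p.K) k // b ∉ (Set.toFinite (bondsIn k (s.Ω (k + 1))ᶜ)).toFinset}))
                    (fun c : {c : PBond (F.P p.K) (k + 1) // c ∉ (Set.toFinite (bondsIn (k + 1) (s.Ω (k + 1))ᶜ)).toFinset} =>
                      ϑ c ((MeasurableEquiv.piEquivPiSubtypeProd (fun _ : PBond (F.P p.K) k => SU N)
                        (· ∈ (Set.toFinite (bondsIn k (s.Ω (k + 1))ᶜ)).toFinset)).symm (y, uin))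
                        ((MeasurableEquiv.piEquivPiSubtypeProd (fun _ : PBond (F.P p.K) (k + 1) => SU N)
                          (· ∈ (Set.toFinite (bondsIn (k + 1) (s.Ω (k + 1))ᶜ)).toFinset) V').2 c)) uin)))
              ∂(Measure.pi fun _ : {b : PBond (F.P p.K) k // b ∉ (Set.toFinite (bondsIn k (s.Ω (k + 1))ᶜ)).toFinset} => (HaarData.haar : Measure (SU N))))
            (MeasurableEquiv.piEquivPiSubtypeProd (fun _ : PBond (F.P p.K) (k + 1) => SU N)
              (· ∈ (Set.toFinite (bondsIn (k + 1) (s.Ω (k + 1))ᶜ)).toFinset) V').1 := by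
  obtain ⟨T, ϑ, jd, hTm, hθm, hjm, h⟩ := exists_ae_forall_tstepOfRecord_eq_kernelRTOfRecord_innerCentralWindow_atRegions p θ.ν θ.τ9.M
    (wOfRecord₉ F N θ.toStage9Params) (gOfRecord₁₃ F N θ.toStage13Params p) hk
    (slotsOfRecord F N θ.ν θ.τ9 (EOfRecord₁₃ F N θ.toStage13Params) (wOfRecord₉ F N θ.toStage9Params) θ.ppSel p (gOfRecord₁₃ F N θ.toStage13Params p) k)
    hα0 hα hαδ hgap hw hwj hχ hslot hwS hGi
  refine ⟨T, ϑ, jd, hTm, hθm, hjm, ?_⟩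
  filter_upwards [h] with V' hV' s
  rw [slotsTOfRecord_succ]
  exact hV' s

end TStep

end Summit.QuantumFields.YangMills.Theorems.BalabanUVNodesN11TStepInnerCentralWindowChartAtRegions

end
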